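import Summits.Ventures.PercRepro2.CaseOneStarCertT1
import Summits.Ventures.PercRepro2.CaseOneGadgetUWA1BBlockII0
import Summits.Ventures.PercRepro2.CaseOneGadgetUWA1BBlockII1
import Summits.Ventures.PercRepro2.CaseOneGadgetUWA1BBlockII2
import Summits.Ventures.PercRepro2.CaseOneGadgetUWA1BBlockII3
import Summits.Ventures.PercRepro2.CaseOneGadgetUWA1BBlockII4
import Summits.Ventures.PercRepro2.CaseOneGadgetUWA1BBlockII5
import Summits.Ventures.PercRepro2.CaseOneGadgetUWA1BBlockII6
import Summits.Ventures.PercRepro2.CaseOneGadgetUWA1BBlockII7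
import Summits.Ventures.PercRepro2.CaseOneGadgetUWA1BBlockII8
import Summits.Ventures.PercRepro2.CaseOneGadgetUWA1BBlockII9
import Summits.Ventures.PercRepro2.CaseOneGadgetUWA1BBlockII10
import Summits.Ventures.PercRepro2.CaseOneGadgetUWA1BBlockII11
import Summits.Ventures.PercRepro2.CaseOneGadgetUWA1BBlockII12
import Summits.Ventures.PercRepro2.CaseOneGadgetUWA1BBlockII13
import Summits.Ventures.PercRepro2.CaseOneGadgetUWA1BBlockII14
import Summits.Ventures.PercRepro2.CaseOneStarFactsB

/-!
# The gadget `u ~ {w, a₁, b}`, `w ~ {u, a₂, o}` (uwa1b): the cell certificates of `iiAB5` (part 40c)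
(blind cell PercRepro2, p1 g34; the fourth gadget anchor of the six-form calculus — all six forms of the uwa1b gadget
as plain SFacts-cone certificate chains, generated by mining/p1/g34/uwa1b/genu.py = p1 g33's gent_uwa1.py / g25's
geno.py re-targeted; P1-G33 §6–§6″, P1-G34)

Each `eBABII ijk kl` is a nonnegative combination of `(pairwise atom) × (cell)` and cubic cell monomials — or, for the degree-4 ones, `M × eBABII ijk kl` (`M = Σ cᵢ` the total cell mass) is a nonnegative combination of `(atom) × (cell) × (cell)` and quartic cell monomials, then `SFacts.nonneg_of_sum_mul` (`CaseOneStarCertT1`) — exact LP certificates (kit j318477, every certificate re-verified exactly; data/p1/g33/gcerts_ii_uwa1b.json, form `ii`), here as exact `linear_combination`s over `SFacts` (the rational coefficients cleared by their common denominator). -/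

namespace Summit.Ventures.PercRepro2

namespace CaseOne

section CertABII40c
variable {R : Type*} [Field R] [LinearOrder R] [IsStrictOrderedRing R]

set_option maxHeartbeats 0 in
/-- `eBABII32230 ≥ 0`: the combination is identically zero (`ring`). -/
lemma eBABII32230_nonneg (m : SCells R) (_hf : SFactsB m) : 0 ≤ eBABII32230 m := by
  have h : eBABII32230 m = 0 := by
    unfold eBABII32230 cBABII00130 cBABII00230 cBABII01030 cBABII01130 cBABII01230 cBABII02030 cBABII02130 cBABII02230 cBABII10130 cBABII10230 cBABII11030 cBABII11130 cBABII11230 cBABII12030 cBABII12130 cBABII12230 cBABII20130 cBABII20230 cBABII21030 cBABII21130 cBABII21230 cBABII22030 cBABII22130 cBABII22230 cBABII30230 cBABII31130 cBABII31230 cBABII32030 cBABII32130 cBABII32230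
    ring
  linarith [h]

set_option maxHeartbeats 0 in
/-- `eBABII32231 ≥ 0`: the combination is identically zero (`ring`). -/
lemma eBABII32231_nonneg (m : SCells R) (_hf : SFactsB m) : 0 ≤ eBABII32231 m := by
  have h : eBABII32231 m = 0 := by
    unfold eBABII32231 cBABII00131 cBABII00231 cBABII01031 cBABII01131 cBABII01231 cBABII02031 cBABII02131 cBABII02231 cBABII10131 cBABII10231 cBABII11031 cBABII11131 cBABII11231 cBABII12031 cBABII12131 cBABII12231 cBABII20131 cBABII20231 cBABII21031 cBABII21131 cBABII21231 cBABII22031 cBABII22131 cBABII22231 cBABII30231 cBABII31131 cBABII31231 cBABII32031 cBABII32131 cBABII32231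
    ring
  linarith [h]

end CertABII40c

end CaseOne

end Summit.Ventures.PercRepro2
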